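import Mathlib
import HarnessLib
import Summits.KontsevichZagierPeriods.KontsevichZagierPeriods.Theses.FurushoPentagon
import Summits.KontsevichZagierPeriods.KontsevichZagierPeriods.Theorems.FurushoPentagonKernelModuloPeriodConjectureFormalHoffmanSpan
import Summits.KontsevichZagierPeriods.KontsevichZagierPeriods.Theorems.FurushoPentagonKernelModuloPeriodConjectureSectorKernelOfFormalSpan
import Summits.KontsevichZagierPeriods.KontsevichZagierPeriods.Theorems.FurushoPentagonKernelModuloPeriodConjectureLeafLowWeight

/-!
# `KernelModuloPeriodConjecture`, line `Sketch`: the crux on the multiple-zeta sector, weight by weight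

Crux `FurushoPentagon.KernelModuloPeriodConjecture` (stmt-KontsevichZagierPeriods-15058,
`MzvPeriodConjecture → PentagonInKZ → ReducedPeriodRing → SectorToKernel`), line `Sketch`.
The landed transfer `mzvSectorKernel_of` (G2 ∘ G1) consumes the algebraic leaf
`AssociatorHoffmanSpanning` for ALL admissible indices at once. Both halves are in fact LOCAL in the
index: G1 reads the leaf at the rules associator `Φ_P ∈ P_ℚ⟨⟨X₀,X₁⟩⟩` one index at a time, and G2
only expands the generators that actually occur in the `ℤ`-combination. This file records the
localisation:

* `formalHoffmanSpan_of_leafAt` — `PentagonInKZ → ReducedPeriodRing →` (the leaf for ONE admissible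
  `s`) `→ 1 ⊗ ⟦ζ(s)⟧ ∈ span_ℚ {1 ⊗ ⟦ζ(t)⟧ : t Hoffman}` in `P_ℚ`;
* `sectorKernel_of_formalSpanOn` — for any set `Q` of indices: formal Hoffman spanning on `Q` and
  `MzvPeriodConjecture` give Conjecture 1 in kernel form on the subgroup generated by the simplex
  classes `[mzvRep s]`, `s ∈ Q`;
* `mzvSectorKernel_of_leafOn` — the two composed: the crux ON THE SPAN OF THE `Q`-CLASSES follows from
  its three antecedents and the leaf on `Q` alone;
* `mzvSectorKernel_of_weight_le_four` — hence, by the landed weight-`≤ 4` slice of the leaf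
  (`associatorHoffmanSpanning_of_weight_le_four`), UNCONDITIONALLY IN THE LEAF: under
  `PentagonInKZ`, `ReducedPeriodRing` and `MzvPeriodConjecture`, every `ℤ`-combination of simplex
  representations `[mzvRep s]` of weights `≤ 4` with value `0` lies in `KZ.relations` — the crux
  holds on the multiple-zeta sector through weight 4 (the per-weight files extend the range).

References: F. Brown, Ann. of Math. 175 (2012), Thm 1.1 [Brown2012]; H. Furusho, Ann. of Math. 174
(2011), Thm 1.2 [Furusho2011]; M. Kontsevich, D. Zagier, *Periods* (2001), §1.2, §4.1
[KontsevichZagier2001]; K. Ihara, M. Kaneko, D. Zagier, Compos. Math. 142 (2006) §2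
[IharaKanekoZagier2006].
-/

noncomputable section

namespace Summit.KontsevichZagierPeriods.FurushoPentagon.KernelModuloPeriodConjecture

open Literature.NumberTheory.Transcendental
open Literature.NumberTheory.Transcendental.KZ
open Summit.KontsevichZagierPeriods.KontsevichZagierPeriods.Theses.FurushoPentagon
open Summit.KontsevichZagierPeriods.FurushoPentagon.PentagonInKZNegative
  (pentagonInKZ_iff_rulesAssociator)
open Summit.KontsevichZagierPeriods.FurushoPentagon.DoubleShuffleOfPentagon
  (isReduced_formalPeriodAlgebra)

/-- **G1, one index at a time.** Under `PentagonInKZ` and `ReducedPeriodRing`, the algebraic leaf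
for a single admissible `s` (a Hoffman reduction of `c_{binaryWord s}` valid at every group-like
pentagon solution over every reduced commutative `ℚ`-algebra), read at the rules associator `Φ_P`
over the reduced `ℚ`-algebra `P_ℚ`, gives `1 ⊗ ⟦ζ(s)⟧ ∈ span_ℚ {1 ⊗ ⟦ζ(t)⟧ : t Hoffman}`.
[cite: Furusho2011, §2] -/
theorem formalHoffmanSpan_of_leafAt (hP : PentagonInKZ) (hR : ReducedPeriodRing) {s : List ℕ}
    (hs : MZV.IsAdmissible s)
    (hA : ∃ b : List ℕ →₀ ℚ, (∀ t ∈ b.support, MZV.IsHoffman t ∧ MZV.weight t = MZV.weight s) ∧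
      ∀ (R : Type) [CommRing R] [Algebra ℚ R] [IsReduced R] (φ : NCSeries Bool R),
        NCSeries.IsGroupLike φ → NCSeries.DrinfeldPentagon φ →
          φ (MZV.binaryWord s) = b.sum (fun t q => q • φ (MZV.binaryWord t))) :
    KZ.toPeriodAlgebra (KZ.mzvClass s) ∈ Submodule.span ℚ
      (Set.range (fun t : {t : List ℕ // MZV.IsHoffman t} => KZ.toPeriodAlgebra (KZ.mzvClass t.1))) := by
  haveI : IsReduced KZ.FormalPeriodAlgebra := isReduced_formalPeriodAlgebra hR
  have hPent : NCSeries.DrinfeldPentagon KZ.rulesAssociator := pentagonInKZ_iff_rulesAssociator.mp hP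
  obtain ⟨b, hb, hall⟩ := hA
  have key := hall KZ.FormalPeriodAlgebra KZ.rulesAssociator isGroupLike_rulesAssociator hPent
  rw [KZ.rulesAssociator_binaryWord hs] at key
  have hx : KZ.toPeriodAlgebra (KZ.mzvClass s) =
      (-1 : KZ.FormalPeriodAlgebra) ^ MZV.depth s *
        b.sum (fun t q => q • KZ.rulesAssociator (MZV.binaryWord t)) := by
    rw [← key, ← mul_assoc, ← pow_add, ← two_mul, pow_mul, neg_one_sq, one_pow, one_mul]
  rw [hx, formalSpan_neg_one_pow_mul]
  refine Submodule.smul_mem _ _ ?_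
  rw [Finsupp.sum]
  refine Submodule.sum_mem _ fun t ht => ?_
  have hH : MZV.IsHoffman t := (hb t ht).1
  rw [KZ.rulesAssociator_binaryWord hH.isAdmissible, formalSpan_neg_one_pow_mul]
  refine Submodule.smul_mem _ _ (Submodule.smul_mem _ _ (Submodule.subset_span ?_))
  exact ⟨⟨t, hH⟩, rfl⟩

/-- **G2, on a set of indices.** If `1 ⊗ ⟦ζ(s)⟧` is a `ℚ`-combination of Hoffman classes in `P_ℚ`
for every admissible `s ∈ Q` and the real Hoffman values are `ℚ`-linearly independent
(`MzvPeriodConjecture`), then every `ℤ`-combination of the simplex classes `[mzvRep s]`, `s ∈ Q`, of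
value `0` is a relation (expand in `P_ℚ`, evaluate, kill the coefficients by independence, pull back
along `P ↪ P_ℚ`, i.e. the proved `IntegerDivision`). [cite: Brown2012, Thm 1.1] -/
theorem sectorKernel_of_formalSpanOn (Q : List ℕ → Prop)
    (hspan : ∀ s : List ℕ, MZV.IsAdmissible s → Q s → KZ.toPeriodAlgebra (KZ.mzvClass s) ∈
      Submodule.span ℚ (Set.range (fun t : {t : List ℕ // MZV.IsHoffman t} =>
        KZ.toPeriodAlgebra (KZ.mzvClass t.1))))
    (hZ : MzvPeriodConjecture) :
    ∀ c ∈ AddSubgroup.closure (Set.range (fun s : {s : List ℕ // MZV.IsAdmissible s ∧ Q s} =>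
      KZ.of (KZ.mzvRep s.1 s.2.1 (KZ.mzvIntegrand_isSemialgebraicFunOn_holds s.1)
        (KZ.mzvIntegrand_integrableOn_holds s.1 s.2.1)))), KZ.eval c = 0 → c ∈ KZ.relations := by
  intro c hc hev
  obtain ⟨ψ, hψ⟩ : ∃ ψ : FormalRep →+ FormalPeriodAlgebra,
      ∀ c : FormalRep, ψ c = toPeriodAlgebra (toFormalPeriod c) :=
    ⟨(toPeriodAlgebra : FormalPeriodRing →ₐ[ℤ] FormalPeriodAlgebra).toRingHom.toAddMonoidHom.comp
        (toFormalPeriod : FormalRep →ₙ+* FormalPeriodRing).toAddMonoidHom, fun _ => rfl⟩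
  have hcH : ψ c ∈ Submodule.span ℚ
      (Set.range (fun t : {t : List ℕ // MZV.IsHoffman t} => toPeriodAlgebra (mzvClass t.1))) := by
    have hle : AddSubgroup.closure (Set.range (fun s : {s : List ℕ // MZV.IsAdmissible s ∧ Q s} =>
        of (mzvRep s.1 s.2.1 (mzvIntegrand_isSemialgebraicFunOn_holds s.1)
          (mzvIntegrand_integrableOn_holds s.1 s.2.1)))) ≤
        (Submodule.span ℚ (Set.range (fun t : {t : List ℕ // MZV.IsHoffman t} =>
          toPeriodAlgebra (mzvClass t.1)))).toAddSubgroup.comap ψ := by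
      rw [AddSubgroup.closure_le]
      rintro _ ⟨s, rfl⟩
      rw [SetLike.mem_coe, AddSubgroup.mem_comap, Submodule.mem_toAddSubgroup, hψ,
        ← mzvClass_of_isAdmissible s.2.1]
      exact hspan s.1 s.2.1 s.2.2
    exact hle hc
  obtain ⟨q, hq⟩ := (Finsupp.mem_span_range_iff_exists_finsupp).1 hcH
  have hq0 : evalPQ (ψ c) = Finsupp.linearCombination ℚ
      (fun u : {u : List ℕ // MZV.IsHoffman u} => multipleZeta u.1) q := by
    rw [← hq, Finsupp.linearCombination_apply, map_finsuppSum]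
    exact Finsupp.sum_congr fun t _ => by
      rw [map_smul, evalPQ_toPeriodAlgebra, evalP_mzvClass t.2.isAdmissible]
  have hev' : evalPQ (ψ c) = 0 := by
    rw [hψ, evalPQ_toPeriodAlgebra, evalP_toFormalPeriod, hev]
  have hZ' : LinearIndependent ℚ (fun u : {u : List ℕ // MZV.IsHoffman u} => multipleZeta u.1) := hZ
  have hq1 : q = 0 := linearIndependent_iff.1 hZ' q (by rw [← hq0, hev'])
  have hψc : toPeriodAlgebra (toFormalPeriod c) = 0 := by
    rw [← hψ, ← hq, hq1, Finsupp.sum_zero_index]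
  exact toFormalPeriod_eq_zero_iff.mp
    ((injective_iff_map_eq_zero toPeriodAlgebra).1 sectorKernel_toPeriodAlgebra_injective _ hψc)

/-- **The crux on the span of the `Q`-classes, from the leaf on `Q` alone.** For any set `Q` of
indices: `PentagonInKZ`, `ReducedPeriodRing`, `MzvPeriodConjecture` and the algebraic leaf for the
admissible `s ∈ Q` give Conjecture 1 in kernel form on the subgroup of `KZ.FormalRep` generated by
the simplex representations `[mzvRep s]`, `s ∈ Q`. [cite: Furusho2011, Thm 1.2] -/
theorem mzvSectorKernel_of_leafOn (Q : List ℕ → Prop)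
    (hleaf : ∀ s : List ℕ, MZV.IsAdmissible s → Q s → ∃ b : List ℕ →₀ ℚ,
      (∀ t ∈ b.support, MZV.IsHoffman t ∧ MZV.weight t = MZV.weight s) ∧
      ∀ (R : Type) [CommRing R] [Algebra ℚ R] [IsReduced R] (φ : NCSeries Bool R),
        NCSeries.IsGroupLike φ → NCSeries.DrinfeldPentagon φ →
          φ (MZV.binaryWord s) = b.sum (fun t q => q • φ (MZV.binaryWord t)))
    (hP : PentagonInKZ) (hR : ReducedPeriodRing) (hZ : MzvPeriodConjecture) :
    ∀ c ∈ AddSubgroup.closure (Set.range (fun s : {s : List ℕ // MZV.IsAdmissible s ∧ Q s} =>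
      KZ.of (KZ.mzvRep s.1 s.2.1 (KZ.mzvIntegrand_isSemialgebraicFunOn_holds s.1)
        (KZ.mzvIntegrand_integrableOn_holds s.1 s.2.1)))), KZ.eval c = 0 → c ∈ KZ.relations :=
  sectorKernel_of_formalSpanOn Q
    (fun _ hs hQ => formalHoffmanSpan_of_leafAt hP hR hs (hleaf _ hs hQ)) hZ

/-- **The crux on the multiple-zeta sector through weight 4, unconditionally in the leaf**: under
`PentagonInKZ`, `ReducedPeriodRing` and `MzvPeriodConjecture`, every `ℤ`-combination of simplex
representations `[mzvRep s]` of weights `≤ 4` with value `0` lies in `KZ.relations` (the weight-`≤ 4`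
slice of the algebraic leaf is the tree theorem `associatorHoffmanSpanning_of_weight_le_four`).
[cite: KontsevichZagier2001, §1.2] -/
theorem mzvSectorKernel_of_weight_le_four (hP : PentagonInKZ) (hR : ReducedPeriodRing)
    (hZ : MzvPeriodConjecture) :
    ∀ c ∈ AddSubgroup.closure (Set.range (fun s : {s : List ℕ // MZV.IsAdmissible s ∧ MZV.weight s ≤ 4} =>
      KZ.of (KZ.mzvRep s.1 s.2.1 (KZ.mzvIntegrand_isSemialgebraicFunOn_holds s.1)
        (KZ.mzvIntegrand_integrableOn_holds s.1 s.2.1)))), KZ.eval c = 0 → c ∈ KZ.relations :=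
  mzvSectorKernel_of_leafOn (fun s => MZV.weight s ≤ 4)
    (fun _ hs hw => associatorHoffmanSpanning_of_weight_le_four hs hw) hP hR hZ

/-- **Registered sub-goal `stub_mzvSectorKernelOfLeafOn`** (crux stmt-KontsevichZagierPeriods-15058, line `Sketch`):
the crux on the span of the `Q`-classes from its three antecedents and the algebraic leaf on `Q` alone
(`mzvSectorKernel_of_leafOn`, `∀`-form). [cite: Furusho2011, Thm 1.2] -/
theorem stub_mzvSectorKernelOfLeafOn : ∀ (Q : List ℕ → Prop), (∀ s : List ℕ, MZV.IsAdmissible s → Q s → ∃ b : List ℕ →₀ ℚ, (∀ t ∈ b.support, MZV.IsHoffman t ∧ MZV.weight t = MZV.weight s) ∧ ∀ (R : Type) [CommRing R] [Algebra ℚ R] [IsReduced R] (φ : NCSeries Bool R), NCSeries.IsGroupLike φ → NCSeries.DrinfeldPentagon φ → φ (MZV.binaryWord s) = b.sum (fun t q => q • φ (MZV.binaryWord t))) → PentagonInKZ → ReducedPeriodRing → MzvPeriodConjecture → ∀ c ∈ AddSubgroup.closure (Set.range (fun s : {s : List ℕ // MZV.IsAdmissible s ∧ Q s} => KZ.of (KZ.mzvRep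 s.1 s.2.1 (KZ.mzvIntegrand_isSemialgebraicFunOn_holds s.1) (KZ.mzvIntegrand_integrableOn_holds s.1 s.2.1)))), KZ.eval c = 0 → c ∈ KZ.relations :=
  fun Q hleaf hP hR hZ => mzvSectorKernel_of_leafOn Q hleaf hP hR hZ

end Summit.KontsevichZagierPeriods.FurushoPentagon.KernelModuloPeriodConjecture

end
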